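import Literature.Computability.Complexity.NPBoundedQuantifiers
import Literature.Computability.Complexity.FPStringBricks
import Literature.Computability.Complexity.FoldBricks
import Literature.Computability.Complexity.ExpTimeMaps
import HarnessLib

/-!
# Upward separation, the names: chains, the census predicate, binary and unary tuples, query maps

Topic `Literature/Computability/Complexity`, second proof file of the named fact
`hartmanisImmermanSewelson1985_thm1` (`SparseSetsUpwardSeparation.lean`). Hartmanis–Immerman–Sewelson
1985, proof of Thm. 1 (Information and Control 65, pp. 163–164) encode a sparse `NP` set `S` into

> `S' = {n#i#j#k#d | ∃ x₁ < x₂ < ⋯ < xᵢ < x < y₁ < ⋯ < yⱼ ∈ S, |x₁| = |yⱼ| = n and the k-th digit of x is d}`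

— "we would like to be able to name a string by its position in the sparse set … we shall use
nondeterminism to be able to simulate knowing a string's position in `S`" (p. 163) — and observe
(p. 164, items 1–3) that the tuples are of length `O(log n)`, that a witness consists of polynomially
many (in `n`) strings of length `n`, each verified by the `NP`-machine of `S`, whence `S' ∈ NEXPTIME`.

The tree's rendering makes ONE simplification of the naming (same idea, same use): a tuple names a
string by the TOTAL number `i` of listed members and its POSITION `j` in the increasing list, instead
of the numbers of members below and above it. This file fixes the vocabulary:

* `UpSep.IsChain S n ys` — `ys` is a strictly increasing (by binary value `bitsToNat`; all words of
  length `n`) list of members of `S ∩ {0,1}ⁿ`, consecutive items compared;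
* `UpSep.Cens S n i j k d :↔ j < i ∧ ∃ ys, |ys| = i ∧ IsChain S n ys ∧ (k < n → ys[j][k] = d)` —
  the census predicate (membership of `n#i#j#k#d` in `S'`);
* `UpSep.ucode n i j k d = ⟨1ⁿ, ⟨1ⁱ, ⟨1ʲ, ⟨1ᵏ, [d]⟩⟩⟩⟩` and
  `UpSep.code n i j k d = ⟨bin n, ⟨bin i, ⟨bin j, ⟨bin k, [d]⟩⟩⟩⟩` (the short name, `O(log n)` bits);
* `UpSep.decodeFn` — the `2^{O(n)}`-time map `code n i j k d ↦ ucode n i j k d` (binary to unary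
  against the exponential ruler `expPad 1`, `binToUnaryFn`): `decodeFn_mem_FE`, `decodeFn_code`;
* the polynomial-time query maps of the `P`-algorithm of p. 164: `UpSep.digitQueryFn`
  (`⟨⟨⟨x, 1ⁱ⟩, 1ʲ⟩, 1ᵏ⟩ ↦ code |x| i j k x[k]`) and `UpSep.censusFn` (`⟨x, 1ⁱ⟩ ↦ code |x| (i+1) 0 |x| 0`),
  both logarithmically short (`length_digitQueryFn_le`, `length_censusFn_le`).

The census language itself (`UpSep.padLang`, in `NP`) is `SparseSetsUpwardSeparationCensus.lean`; the
assembly is `SparseSetsUpwardSeparationProofs.lean`. No named fact and no definition of independent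
mathematical content is introduced (D-0026): all `def`s are proof devices of the discharge, grouped in
the namespace `UpSep`.

## References

* J. Hartmanis, N. Immerman, V. Sewelson, *Sparse sets in NP−P: EXPTIME versus NEXPTIME*,
  Information and Control 65 (1985) 158–181, Thm. 1, pp. 163–164 (held:
  `paper:doi-10-1016-s0019-9958-85-80004-8`, PDF pp. 6–7). [HartmanisImmermanSewelson1985]
* S. Arora, B. Barak, *Computational Complexity: A Modern Approach*, CUP 2009, Def. 2.1, §1.3,
  §2.6.2. [AroraBarakCC2009]
-/
noncomputable section

namespace Literature.Computability.Complexity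

open _root_.Computability Polynomial OracleCompose PRelSigPi

namespace UpSep

/-! ### Chains and the census predicate -/

/-- `IsChain S n ys`: the list `ys` consists of members of `S` of length `n`, strictly increasing
in binary value (consecutive items compared, as the verifier does). This is the witness
"`x₁ < x₂ < ⋯ < xᵢ ∈ S`, `|x₁| = ⋯ = n`" of Hartmanis–Immerman–Sewelson's `S'`.
[cite: HartmanisImmermanSewelson1985, Theorem 1 (proof, p. 163)] -/
structure IsChain (S : Language Bool) (n : ℕ) (ys : List (List Bool)) : Prop where
  mem : ∀ m, m < ys.length → ys.getD m [] ∈ S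
  len : ∀ m, m < ys.length → (ys.getD m []).length = n
  lt : ∀ m, m + 1 < ys.length → bitsToNat (ys.getD m []) < bitsToNat (ys.getD (m + 1) [])

/-- **The census predicate** `Cens S n i j k d`: `j < i` and some chain of `i` members of
`S ∩ {0,1}ⁿ` has `d` as the `k`-th digit of its `j`-th item (no condition if `k ≥ n`). The tree's
rendering of membership of the tuple `n#i#j#k#d` in the set `S'` of Hartmanis–Immerman–Sewelson
(who split `i` into the numbers of listed members below and above the named string).
[cite: HartmanisImmermanSewelson1985, Theorem 1 (proof, p. 163)] -/
def Cens (S : Language Bool) (n i j k : ℕ) (d : Bool) : Prop :=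
  j < i ∧ ∃ ys : List (List Bool), ys.length = i ∧ IsChain S n ys ∧
    (k < n → (ys.getD j []).getD k false = d)

/-! ### Unary and binary tuples -/

/-- The unary tuple `⟨1ⁿ, ⟨1ⁱ, ⟨1ʲ, ⟨1ᵏ, [d]⟩⟩⟩⟩`. [folklore] -/
def ucode (n i j k : ℕ) (d : Bool) : List Bool :=
  boolPair (List.replicate n true) (boolPair (List.replicate i true)
    (boolPair (List.replicate j true) (boolPair (List.replicate k true) [d])))

/-- The binary tuple `⟨bin n, ⟨bin i, ⟨bin j, ⟨bin k, [d]⟩⟩⟩⟩` — the short name `n#i#j#k#d`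
("of length `O(log n)`", p. 164, item 1). [cite: HartmanisImmermanSewelson1985, Theorem 1 (proof, p. 164)] -/
def code (n i j k : ℕ) (d : Bool) : List Bool :=
  boolPair (encodeNat n) (boolPair (encodeNat i) (boolPair (encodeNat j) (boolPair (encodeNat k) [d])))

/-- Length of the unary tuple. [folklore] -/
theorem length_ucode (n i j k : ℕ) (d : Bool) :
    (ucode n i j k d).length = 2 * n + 2 * i + 2 * j + 2 * k + 9 := by
  simp [ucode]; omega

/-- Field `0` of the unary tuple. [folklore] -/
@[simp] theorem nthF_zero_ucode (n i j k : ℕ) (d : Bool) : Brick.nthF 0 (ucode n i j k d) = List.replicate n true := by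
  simp [ucode]

/-- Field `1` of the unary tuple. [folklore] -/
@[simp] theorem nthF_one_ucode (n i j k : ℕ) (d : Bool) : Brick.nthF 1 (ucode n i j k d) = List.replicate i true := by
  simp [ucode]

/-- Field `2` of the unary tuple. [folklore] -/
@[simp] theorem nthF_two_ucode (n i j k : ℕ) (d : Bool) : Brick.nthF 2 (ucode n i j k d) = List.replicate j true := by
  simp [ucode]

/-- Field `3` of the unary tuple. [folklore] -/
@[simp] theorem nthF_three_ucode (n i j k : ℕ) (d : Bool) : Brick.nthF 3 (ucode n i j k d) = List.replicate k true := by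
  simp [ucode]

/-- The last field of the unary tuple. [folklore] -/
@[simp] theorem sndPow_three_ucode (n i j k : ℕ) (d : Bool) : Brick.sndPow 3 (ucode n i j k d) = [d] := by
  simp [ucode]

/-- Binary numerals of numbers `≤ N` have length `≤ log₂ N + 1`. [folklore] -/
theorem length_encodeNat_le_log {m N : ℕ} (h : m ≤ N) : (encodeNat m).length ≤ Nat.log 2 N + 1 := by
  rw [TM2Pass.length_encodeNat_eq_size]
  exact Nat.size_le.2 (lt_of_le_of_lt h (Nat.lt_pow_succ_log_self (by norm_num) N))

/-! ### The decoding map `code ↦ ucode` is computable in time `2^{O(n)}` -/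

/-- Binary-to-unary conversion of field `t` of `u` against the ruler `r`, on arguments `⟨r, u⟩`:
`1^{min ⟦nthF t u⟧ |r|}`. [folklore] -/
def fieldToUnary (t : ℕ) : List Bool → List Bool :=
  binToUnaryFn ∘ pairFn fstP (Brick.nthF t ∘ sndP)

/-- `fieldToUnary t ∈ FP`. [folklore] -/
theorem fieldToUnary_mem_FP (t : ℕ) : fieldToUnary t ∈ FP :=
  comp_mem_FP binToUnaryFn_mem_FP (pairFn_mem_FP fstP_mem_FP (comp_mem_FP (Brick.nthF_mem_FP t) sndP_mem_FP))

/-- Value of `fieldToUnary` on a pair. [folklore] -/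
theorem fieldToUnary_boolPair (t : ℕ) (r u : List Bool) :
    fieldToUnary t (boolPair r u) = List.replicate (min (bitsToNat (Brick.nthF t u)) r.length) true := by
  simp [fieldToUnary, ones]

/-- The polynomial-time core of the decoder, on `⟨r, u⟩`: the four fields of `u` in unary (capped
by `|r|`) and the fifth verbatim. [folklore] -/
def decodeCore : List Bool → List Bool :=
  pairFn (fieldToUnary 0) (pairFn (fieldToUnary 1) (pairFn (fieldToUnary 2)
    (pairFn (fieldToUnary 3) (Brick.sndPow 3 ∘ sndP))))

/-- `decodeCore ∈ FP`. [folklore] -/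
theorem decodeCore_mem_FP : decodeCore ∈ FP :=
  pairFn_mem_FP (fieldToUnary_mem_FP 0) (pairFn_mem_FP (fieldToUnary_mem_FP 1)
    (pairFn_mem_FP (fieldToUnary_mem_FP 2) (pairFn_mem_FP (fieldToUnary_mem_FP 3)
      (comp_mem_FP (Brick.sndPow_mem_FP 3) sndP_mem_FP))))

/-- **The decoder** `decodeFn = decodeCore ∘ (u ↦ ⟨expPad 1 u, u⟩)`: against the exponential ruler
`1^{2^{|u|}} 0 u` no field of `u` is capped, so `decodeFn (code n i j k d) = ucode n i j k d`
(`decodeFn_code`). This is the recovery "of the original string from this short name in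
nondeterministic exponential time" of the position indices (p. 163), here of the unary tuple from
the binary one. [cite: HartmanisImmermanSewelson1985, Theorem 1 (proof, p. 163)] -/
def decodeFn : List Bool → List Bool :=
  decodeCore ∘ (mapFstFn (expPad 1) ∘ copyFn)

/-- **`decodeFn ∈ FE`** (`expPad 1 ∈ FE`, `mapFstFn_mem_FE`, `FP` after `FE`). [folklore] -/
theorem decodeFn_mem_FE : decodeFn ∈ FE := by
  refine comp_mem_FE decodeCore_mem_FP ?_
  refine comp_mem_FE_of_linear (mapFstFn_mem_FE expPad_one_mem_FE) copyFn_mem_FP 3 fun w => ?_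
  rw [copyFn_apply, length_boolPair]
  omega

/-- A field of `u` has value `< 2^{|u|} ≤ |expPad 1 u|`, so the ruler never caps it. [folklore] -/
theorem bitsToNat_nthF_lt_length_expPad (t : ℕ) (u : List Bool) :
    bitsToNat (Brick.nthF t u) < (expPad 1 u).length := by
  have h1 := bitsToNat_lt (Brick.nthF t u)
  have h2 : 2 ^ (Brick.nthF t u).length ≤ 2 ^ u.length :=
    Nat.pow_le_pow_right Nat.two_pos (Brick.length_nthF_le t u)
  rw [length_expPad, pow_one]
  omega

/-- **The decoder inverts the naming**: `decodeFn (code n i j k d) = ucode n i j k d`.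
[cite: HartmanisImmermanSewelson1985, Theorem 1 (proof, p. 163)] -/
theorem decodeFn_code (n i j k : ℕ) (d : Bool) : decodeFn (code n i j k d) = ucode n i j k d := by
  have hc : ∀ t, min (bitsToNat (Brick.nthF t (code n i j k d))) (expPad 1 (code n i j k d)).length =
      bitsToNat (Brick.nthF t (code n i j k d)) :=
    fun t => min_eq_left (bitsToNat_nthF_lt_length_expPad t _).le
  simp only [decodeFn, decodeCore, Function.comp_apply, copyFn_apply, mapFstFn_boolPair, pairFn_apply,
    fieldToUnary_boolPair, hc, sndP_boolPair]
  simp [code, ucode]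

/-! ### The query maps of the polynomial-time algorithm -/

/-- The digit `x[k]` as a one-symbol string, `[x.getD k 0]`, read off `⟨1ᵏ, x⟩`
(`bitAtFn`, padded with a `0` and cut to one symbol so that out-of-range positions give `[0]`).
[folklore] -/
def digitFn : List Bool → List Bool :=
  take1Fn ∘ fun z => bitAtFn z ++ [false]

/-- `digitFn ∈ FP`. [folklore] -/
theorem digitFn_mem_FP : digitFn ∈ FP :=
  comp_mem_FP take1Fn_mem_FP (append_mem_FP bitAtFn_mem_FP (const_mem_FP [false]))

/-- Value of `digitFn`: `digitFn ⟨a, x⟩ = [x.getD |a| 0]`. [folklore] -/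
theorem digitFn_boolPair (a x : List Bool) : digitFn (boolPair a x) = [x.getD a.length false] := by
  simp only [digitFn, Function.comp_apply, bitAtFn_boolPair, take1Fn]
  rcases lt_or_ge a.length x.length with h | h
  · rw [List.take_one_drop_eq_of_lt_length h, List.getD_eq_getElem _ _ h]
    simp
  · rw [List.drop_eq_nil_of_le h, List.getD_eq_default _ _ h]
    simp

/-- **The digit queries** (p. 164: "`{n#i#j#k#d | …, k = 1, 2, …, n` with `d` the appropriate
character of `x}`"): `⟨⟨⟨x, 1ⁱ⟩, 1ʲ⟩, 1ᵏ⟩ ↦ code |x| i j k x[k]`.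
[cite: HartmanisImmermanSewelson1985, Theorem 1 (proof, p. 164)] -/
def digitQueryFn : List Bool → List Bool :=
  pairFn (Brick.lenBinF ∘ fstP ∘ fstP ∘ fstP) (pairFn (Brick.lenBinF ∘ sndP ∘ fstP ∘ fstP)
    (pairFn (Brick.lenBinF ∘ sndP ∘ fstP) (pairFn (Brick.lenBinF ∘ sndP)
      (digitFn ∘ pairFn sndP (fstP ∘ fstP ∘ fstP)))))

/-- `digitQueryFn ∈ FP`. [folklore] -/
theorem digitQueryFn_mem_FP : digitQueryFn ∈ FP :=
  pairFn_mem_FP (comp_mem_FP Brick.lenBinF_mem_FP (comp_mem_FP fstP_mem_FP (comp_mem_FP fstP_mem_FP fstP_mem_FP)))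
    (pairFn_mem_FP (comp_mem_FP Brick.lenBinF_mem_FP (comp_mem_FP sndP_mem_FP (comp_mem_FP fstP_mem_FP fstP_mem_FP)))
      (pairFn_mem_FP (comp_mem_FP Brick.lenBinF_mem_FP (comp_mem_FP sndP_mem_FP fstP_mem_FP))
        (pairFn_mem_FP (comp_mem_FP Brick.lenBinF_mem_FP sndP_mem_FP)
          (comp_mem_FP digitFn_mem_FP (pairFn_mem_FP sndP_mem_FP
            (comp_mem_FP fstP_mem_FP (comp_mem_FP fstP_mem_FP fstP_mem_FP)))))))

/-- **Value of the digit query map.** [folklore] -/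
theorem digitQueryFn_apply (x : List Bool) (i j k : ℕ) :
    digitQueryFn (boolPair (boolPair (boolPair x (List.replicate i true)) (List.replicate j true))
      (List.replicate k true)) = code x.length i j k (x.getD k false) := by
  simp [digitQueryFn, code, digitFn_boolPair]

/-- **The census queries** (p. 164: "asking if … is in `S'` is simply asking if there are at least
`i` strings of length `n` in `S`"): `⟨x, 1ⁱ⟩ ↦ code |x| (i+1) 0 |x| 0`, the name whose membership
in `S'` says "some chain of `i + 1` members of `S ∩ {0,1}^{|x|}` exists".
[cite: HartmanisImmermanSewelson1985, Theorem 1 (proof, p. 164)] -/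
def censusFn : List Bool → List Bool :=
  pairFn (Brick.lenBinF ∘ fstP) (pairFn (Brick.lenBinF ∘ List.cons true ∘ sndP)
    (pairFn (fun _ => encodeNat 0) (pairFn (Brick.lenBinF ∘ fstP) fun _ => [false])))

/-- `censusFn ∈ FP`. [folklore] -/
theorem censusFn_mem_FP : censusFn ∈ FP :=
  pairFn_mem_FP (comp_mem_FP Brick.lenBinF_mem_FP fstP_mem_FP)
    (pairFn_mem_FP (comp_mem_FP Brick.lenBinF_mem_FP (comp_mem_FP (cons_mem_FP true) sndP_mem_FP))
      (pairFn_mem_FP (const_mem_FP (encodeNat 0)) (pairFn_mem_FP (comp_mem_FP Brick.lenBinF_mem_FP fstP_mem_FP)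
        (const_mem_FP [false]))))

/-- **Value of the census query map.** [folklore] -/
theorem censusFn_apply (x : List Bool) (i : ℕ) :
    censusFn (boolPair x (List.replicate i true)) = code x.length (i + 1) 0 x.length false := by
  simp [censusFn, code]

/-- Both parts of the pair decoder are short. [folklore] -/
theorem length_parts_le (z : List Bool) : (fstP z).length ≤ z.length ∧ (sndP z).length ≤ z.length := by
  have := Brick.length_fstF_sndF_le z
  simp only [Brick.fstF, Brick.sndF] at this
  change (boolUnpair z).1.length ≤ _ ∧ (boolUnpair z).2.length ≤ _
  omega

/-- Length of a binary tuple whose entries are at most `N`: `≤ 8 log₂ N + 17`. [folklore] -/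
theorem length_code_le {n i j k N : ℕ} (hn : n ≤ N) (hi : i ≤ N) (hj : j ≤ N) (hk : k ≤ N) (d : Bool) :
    (code n i j k d).length ≤ 8 * Nat.log 2 N + 17 := by
  have h1 := length_encodeNat_le_log hn
  have h2 := length_encodeNat_le_log hi
  have h3 := length_encodeNat_le_log hj
  have h4 := length_encodeNat_le_log hk
  simp only [code, length_boolPair, List.length_singleton]
  omega

/-- **The digit queries are logarithmically short**: `|digitQueryFn w| ≤ 8 log₂ |w| + 17`. [folklore] -/
theorem length_digitQueryFn_le (w : List Bool) : (digitQueryFn w).length ≤ 8 * Nat.log 2 w.length + 17 := by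
  have hx : (fstP (fstP (fstP w))).length ≤ w.length :=
    (length_parts_le _).1.trans ((length_parts_le _).1.trans (length_parts_le _).1)
  have hi : (sndP (fstP (fstP w))).length ≤ w.length :=
    (length_parts_le _).2.trans ((length_parts_le _).1.trans (length_parts_le _).1)
  have hj : (sndP (fstP w)).length ≤ w.length := (length_parts_le _).2.trans (length_parts_le _).1
  have hk : (sndP w).length ≤ w.length := (length_parts_le _).2
  have h := length_code_le hx hi hj hk ((fstP (fstP (fstP w))).getD (sndP w).length false)
  have he : digitQueryFn w = code (fstP (fstP (fstP w))).length (sndP (fstP (fstP w))).length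
      (sndP (fstP w)).length (sndP w).length ((fstP (fstP (fstP w))).getD (sndP w).length false) := by
    have hd : digitFn (boolPair (sndP w) (fstP (fstP (fstP w)))) =
        [(fstP (fstP (fstP w))).getD (sndP w).length false] := digitFn_boolPair _ _
    simp [digitQueryFn, code, hd]
  rw [he]
  exact h

/-- **The census queries are logarithmically short**: `|censusFn w| ≤ 8 log₂ (|w| + 1) + 17`.
[folklore] -/
theorem length_censusFn_le (w : List Bool) : (censusFn w).length ≤ 8 * Nat.log 2 (w.length + 1) + 17 := by
  have hx : (fstP w).length ≤ w.length + 1 := (length_parts_le _).1.trans (Nat.le_succ _)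
  have hi : (sndP w).length + 1 ≤ w.length + 1 := Nat.succ_le_succ (length_parts_le _).2
  have h := length_code_le hx hi (Nat.zero_le _) hx false
  have he : censusFn w = code (fstP w).length ((sndP w).length + 1) 0 (fstP w).length false := by
    simp [censusFn, code]
  rw [he]
  exact h

end UpSep

end Literature.Computability.Complexity
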